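import Summits.AtomisticToContinuum.BoseEinsteinCondensation.Theorems.BECThomsonPrinciplePeriodicToDirichletDefs

/-!
# Route `BECThomsonPrinciple`, crux `PeriodicToDirichlet` (stmt-AtomisticToContinuum-9483),
# line `reward-pays-the-wall` — stub `stub_rewardedUpperBound`

The registered stub `stub_rewardedUpperBound : RewardedUpperBoundOfTorusBEC` of the line's
skeleton (`Theorems/BECThomsonPrinciplePeriodicToDirichletDefs.lean` holds the vocabulary and the
statement): given the padded cut-off state (`PaddedCutoffState`), torus BEC of the genuine periodic
near-minimisers at `(v, ρ, c)` (`TorusBECAt`, the crux hypothesis used once) yields the rewarded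
upper bound `F^D(λ; N, L_N(ρ)) ≤ N (e₀(ρ) + θ + λ (1 - c + θ))` eventually in `N`, for every
`θ > 0`, `λ ≥ 0` (`RewardedUpperBound`).

Proof: bookkeeping on the PROVED periodic thermodynamic limit
(`LSSY2005_e0_periodic_eq_dirichlet_dilute`, `limsup_lt_top_of_small`, `e0 = limUnder`): with
`N = ⌊N''/(1+7/M)⌋`, a periodic `N`-body trial state within `min(δ, θN)` of
`E₀^per(N, L_N) < ∞` (`iInf_lt_iff`) is condensed by torus BEC and has energy `≤ N(e₀ + 2θ)`;
its padded cut-off state `Φ` (Dirichlet, `N''` particles, box of side `L_{N''}`) has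
`R_λ(Φ) ≤ N''(e₀ + θ₀) + λ N''(1 - c + θ₀)`, and `F^D(λ) ≤ R_λ(Φ)` (`rewardedInf_le`).

References: LSSY 2005, §1.2 (1.17)–(1.19), Ch. 2 after (2.2); Ruelle 1969, §3.5.11.
-/

noncomputable section

open MeasureTheory Filter
open scoped ENNReal NNReal

namespace Summit.AtomisticToContinuum.BoseEinsteinCondensation.RewardPaysTheWall

open Literature.MathematicalPhysics.QuantumManyBody.BoseGas

/-! ## The rewarded upper bound from torus BEC (`stub_rewardedUpperBound`)

Bookkeeping on the proved periodic thermodynamic limit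
(`LSSY2005_e0_periodic_eq_dirichlet_dilute`): given `θ₀ > 0` and `λ ≥ 0`, fix `θ ≪ θ₀` and a
padding parameter `M` (`21/M ≤ θ₀/2`); every large `N''` lies in `[(1+7/M)N, (1+7/M)N+3]` for
`N = ⌊N''/(1+7/M)⌋`; torus BEC at `N` gives a slack `δ`; a periodic trial state within
`min(δ, θN)` of `E₀^per(N, L_N) < ∞` (`iInf_lt_iff`) is condensed, `n₀ ≥ cN`, and has energy
`≤ N(e₀ + 2θ)`; the padded cut-off state turns it into a Dirichlet `N''`-body state `Φ` in the box
of side `L_{N''}` whose rewarded energy is evaluated (`rewardedInf_le`). -/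

section RewardedUpperBound

open scoped Topology

/-- `ℝ≥0∞` bookkeeping: a lower bound `ofReal y ≤ a` gives `n - a ≤ ofReal (n - y)`. [folklore] -/
private theorem natCast_sub_le_ofReal {n : ℕ} {y : ℝ} {a : ℝ≥0∞} (h : ENNReal.ofReal y ≤ a) :
    (n : ℝ≥0∞) - a ≤ ENNReal.ofReal (n - y) := by
  rw [tsub_le_iff_right]
  calc (n : ℝ≥0∞) = ENNReal.ofReal ((n - y) + y) := by rw [sub_add_cancel, ENNReal.ofReal_natCast]
    _ ≤ ENNReal.ofReal (n - y) + ENNReal.ofReal y := ENNReal.ofReal_add_le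
    _ ≤ ENNReal.ofReal (n - y) + a := add_le_add le_rfl h

/-- Real bookkeeping: `C'(N/L²) ≤ (θ₀/4) N` once `L ≥ max 1 (4C'/θ₀)`. [folklore] -/
private theorem const_mul_div_sq_le {C' θ₀ L N : ℝ} (hθ₀ : 0 < θ₀) (hN : 0 ≤ N)
    (hL : max 1 (4 * C' / θ₀) ≤ L) : C' * (N / L ^ 2) ≤ θ₀ / 4 * N := by
  have hL1 : 1 ≤ L := (le_max_left _ _).trans hL
  have hL2 : 4 * C' / θ₀ ≤ L := (le_max_right _ _).trans hL
  have hL0 : 0 < L := one_pos.trans_le hL1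
  rw [div_le_iff₀ hθ₀] at hL2
  have hLL : L ≤ L ^ 2 := by nlinarith
  have h4 : C' ≤ θ₀ / 4 * L ^ 2 := by nlinarith
  calc C' * (N / L ^ 2) = C' / L ^ 2 * N := by ring
    _ ≤ θ₀ / 4 * N :=
        mul_le_mul_of_nonneg_right ((div_le_iff₀ (by positivity)).2 h4) hN

/-- Real bookkeeping for the energy: `(1+θ)(e+2θ)N + C'(1+q) + θN ≤ N''(e+θ₀)`. [folklore] -/
private theorem energy_bookkeeping {e θ θ₀ C' q N N'' : ℝ} (he : 0 ≤ e) (hθ : 0 ≤ θ) (hθ1 : θ ≤ 1)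
    (hθe : θ * (e + 6) ≤ θ₀ / 2) (hN : 0 ≤ N) (hNN : N ≤ N'') (hC1 : C' ≤ θ₀ / 4 * N)
    (hC2 : C' * q ≤ θ₀ / 4 * N) :
    (1 + θ) * ((e + 2 * θ) * N) + (C' * (1 + q) + θ * N) ≤ N'' * (e + θ₀) := by
  have hθθ : θ * θ ≤ θ * 1 := mul_le_mul_of_nonneg_left hθ1 hθ
  have hθe' : 0 ≤ θ * e := mul_nonneg hθ he
  have hθ₀ : 0 ≤ θ₀ := by nlinarith
  have h1 : (1 + θ) * (e + 2 * θ) + θ ≤ e + θ₀ / 2 := by nlinarith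
  have h2 : ((1 + θ) * (e + 2 * θ) + θ) * N ≤ (e + θ₀ / 2) * N :=
    mul_le_mul_of_nonneg_right h1 hN
  have h3 : (e + θ₀) * N ≤ (e + θ₀) * N'' := mul_le_mul_of_nonneg_left hNN (by positivity)
  nlinarith

/-- Real bookkeeping for the occupation: `1 - r³(c - θ) ≤ 1 - c + θ₀` for `r, c ∈ [0,1]`,
`3(1 - r) + θ ≤ θ₀`. [folklore] -/
private theorem occupation_bookkeeping {c θ θ₀ r : ℝ} (hc1 : c ≤ 1) (hθ : 0 ≤ θ) (hr0 : 0 ≤ r)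
    (hr1 : r ≤ 1) (h : 3 * (1 - r) + θ ≤ θ₀) :
    1 - r ^ 2 * (c - θ) * r ≤ 1 - c + θ₀ := by
  have hr3 : r ^ 3 ≤ 1 := pow_le_one₀ hr0 hr1
  have hr3' : 0 ≤ r ^ 3 := pow_nonneg hr0 3
  have h1 : 1 - r ^ 3 ≤ 3 * (1 - r) := by
    nlinarith [mul_nonneg (sq_nonneg (r - 1)) (by linarith : 0 ≤ r + 2)]
  have h2 : c * (1 - r ^ 3) ≤ 1 * (1 - r ^ 3) :=
    mul_le_mul_of_nonneg_right hc1 (sub_nonneg.2 hr3)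
  have h3 : θ * r ^ 3 ≤ θ * 1 := mul_le_mul_of_nonneg_left hr3 hθ
  nlinarith

/-- Floor bookkeeping for `N = ⌊N''/(1+t)⌋`: `(1+t)N ≤ N'' ≤ (1+t)N + 3`, `N ≤ N''` and
`3(N'' - N) ≤ (θ₀/2) N'' + 3` (for `0 ≤ t ≤ 2`, `3t ≤ θ₀/2`). [folklore] -/
private theorem floor_bookkeeping {t θ₀ : ℝ} (ht0 : 0 ≤ t) (ht2 : t ≤ 2) (h21 : 3 * t ≤ θ₀ / 2)
    (N'' : ℕ) :
    (1 + t) * ⌊(N'' : ℝ) / (1 + t)⌋₊ ≤ N'' ∧ (N'' : ℝ) ≤ (1 + t) * ⌊(N'' : ℝ) / (1 + t)⌋₊ + 3 ∧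
      (⌊(N'' : ℝ) / (1 + t)⌋₊ : ℝ) ≤ N'' ∧
        3 * ((N'' : ℝ) - ⌊(N'' : ℝ) / (1 + t)⌋₊) ≤ θ₀ / 2 * N'' + 3 := by
  have hK0 : (0 : ℝ) < 1 + t := by linarith
  have hfl : (⌊(N'' : ℝ) / (1 + t)⌋₊ : ℝ) ≤ (N'' : ℝ) / (1 + t) := Nat.floor_le (by positivity)
  have hlf : (N'' : ℝ) / (1 + t) < ⌊(N'' : ℝ) / (1 + t)⌋₊ + 1 := Nat.lt_floor_add_one _
  have hqN : (N'' : ℝ) / (1 + t) * (1 + t) = N'' := div_mul_cancel₀ _ hK0.ne'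
  have hqle : (N'' : ℝ) / (1 + t) ≤ N'' := div_le_self (Nat.cast_nonneg _) (by linarith)
  have h1 := mul_le_mul_of_nonneg_right hfl hK0.le
  have h2 := mul_lt_mul_of_pos_right hlf hK0
  have h3 := mul_le_mul_of_nonneg_right hqle ht0
  have h4 := mul_le_mul_of_nonneg_left h21 (Nat.cast_nonneg N'' : (0 : ℝ) ≤ N'')
  refine ⟨by nlinarith, by nlinarith, by nlinarith, by nlinarith⟩

/-- **One step of the rewarded upper bound.** At a pair `(N, N'')` with `N ≤ N''`,
`3(N'' - N) ≤ (θ₀/2)N'' + 3`, `N'' ≥ 12/θ₀`: if `E₀^per(N, L_N)/N < e + θ`, torus BEC holds at `N`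
with slack `δ` and constant `c`, and every periodic `N`-body state has a padded cut-off state
(`PaddedCutoffState` at `(N, N'')`), then `F^D(λ; N'', L_{N''}) ≤ N''(e + θ₀ + λ(1 - c + θ₀))`.
[folklore] -/
private theorem rewardedInf_le_of_step {v : ℝ → ℝ≥0∞} {ρ c lam θ θ₀ e C : ℝ} {N N'' : ℕ}
    {δ : ℝ≥0∞} (hc1 : c ≤ 1) (hlam : 0 ≤ lam) (he : 0 ≤ e) (hθ : 0 < θ) (hθ1 : θ ≤ 1)
    (hθ₀ : 0 < θ₀) (hθe : θ * (e + 6) ≤ θ₀ / 2) (hN1 : 1 ≤ N)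
    (hNN'' : (N : ℝ) ≤ N'') (hdiff : 3 * ((N'' : ℝ) - N) ≤ θ₀ / 2 * N'' + 3)
    (h12 : 12 / θ₀ ≤ (N'' : ℝ)) (hC1 : 4 * max C 0 / θ₀ ≤ (N : ℝ))
    (hL : max 1 (4 * max C 0 / θ₀) ≤ sideLength ρ N)
    (hE0 : periodicGroundStateEnergy v N (sideLength ρ N) / N < ENNReal.ofReal (e + θ))
    (hδ : 0 < δ)
    (hBEC : ∀ Ψ : PeriodicTrialState N (sideLength ρ N),
      periodicEnergy v Ψ ≤ periodicGroundStateEnergy v N (sideLength ρ N) + δ →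
        ENNReal.ofReal (c * N) ≤ condensateOccupation N (sideLength ρ N) Ψ.ψ)
    (hpad : ∀ Ψ : PeriodicTrialState N (sideLength ρ N), ∃ Φ : TrialState N'' (sideLength ρ N''),
      energy v Φ ≤ (1 + ENNReal.ofReal θ) * periodicEnergy v Ψ +
          ENNReal.ofReal (C * (1 + N / sideLength ρ N ^ 2) + θ * N) ∧
        ENNReal.ofReal (((N : ℝ) / N'') ^ 2) *
            (condensateOccupation N (sideLength ρ N) Ψ.ψ - ENNReal.ofReal (θ * N)) ≤
          occupation N'' (boxConstantMode (sideLength ρ N'')) Φ.ψ) :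
    rewardedInf v lam N'' (sideLength ρ N'') ≤
      ENNReal.ofReal ((N'' : ℝ) * (e + θ₀ + lam * (1 - c + θ₀))) := by
  have hN0 : (0 : ℝ) < N := by exact_mod_cast hN1
  have hN''0 : (0 : ℝ) < N'' := hN0.trans_le hNN''
  -- `E₀^per(N, L_N) < (e + θ) N < ∞`
  have hE0' : periodicGroundStateEnergy v N (sideLength ρ N) < ENNReal.ofReal ((e + θ) * N) := by
    rw [ENNReal.div_lt_iff (Or.inl (Nat.cast_ne_zero.2 (by omega)))
      (Or.inl (ENNReal.natCast_ne_top _))] at hE0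
    rwa [ENNReal.ofReal_mul (by positivity), ENNReal.ofReal_natCast]
  -- a genuine periodic near-minimiser, within `min δ (θ N)` of `E₀^per`
  have hδ' : 0 < min δ (ENNReal.ofReal (θ * N)) :=
    lt_min hδ (ENNReal.ofReal_pos.2 (by positivity))
  obtain ⟨Ψ, hΨ⟩ : ∃ Ψ : PeriodicTrialState N (sideLength ρ N), periodicEnergy v Ψ <
      periodicGroundStateEnergy v N (sideLength ρ N) + min δ (ENNReal.ofReal (θ * N)) :=
    iInf_lt_iff.1 (ENNReal.lt_add_right hE0'.ne_top hδ'.ne')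
  have hocc : ENNReal.ofReal (c * N) ≤ condensateOccupation N (sideLength ρ N) Ψ.ψ :=
    hBEC Ψ (hΨ.le.trans (add_le_add le_rfl (min_le_left _ _)))
  have hΨE : periodicEnergy v Ψ ≤ ENNReal.ofReal ((e + 2 * θ) * N) :=
    calc periodicEnergy v Ψ
        ≤ periodicGroundStateEnergy v N (sideLength ρ N) + ENNReal.ofReal (θ * N) :=
          hΨ.le.trans (add_le_add le_rfl (min_le_right _ _))
      _ ≤ ENNReal.ofReal ((e + θ) * N) + ENNReal.ofReal (θ * N) := add_le_add hE0'.le le_rfl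
      _ = ENNReal.ofReal ((e + 2 * θ) * N) := by
          rw [← ENNReal.ofReal_add (by positivity) (by positivity)]; ring_nf
  -- the padded cut-off state of `Ψ`
  obtain ⟨Φ, hΦE, hΦocc⟩ := hpad Ψ
  refine (rewardedInf_le v lam Φ).trans ?_
  -- its energy
  have hC1' : max C 0 ≤ θ₀ / 4 * N := by
    rw [div_le_iff₀ hθ₀] at hC1
    linarith
  have hC2' : max C 0 * (N / sideLength ρ N ^ 2) ≤ θ₀ / 4 * N :=
    const_mul_div_sq_le hθ₀ hN0.le hL
  have hEΦ : energy v Φ ≤ ENNReal.ofReal ((N'' : ℝ) * (e + θ₀)) :=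
    calc energy v Φ ≤ _ := hΦE
      _ ≤ (1 + ENNReal.ofReal θ) * ENNReal.ofReal ((e + 2 * θ) * N) +
            ENNReal.ofReal (max C 0 * (1 + N / sideLength ρ N ^ 2) + θ * N) :=
          add_le_add (mul_le_mul_right hΨE _) (ENNReal.ofReal_le_ofReal (add_le_add
            (mul_le_mul_of_nonneg_right (le_max_left _ _) (by positivity)) le_rfl))
      _ = ENNReal.ofReal ((1 + θ) * ((e + 2 * θ) * N) +
            (max C 0 * (1 + N / sideLength ρ N ^ 2) + θ * N)) := by
          symm
          rw [ENNReal.ofReal_add (by positivity) (by positivity),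
            ENNReal.ofReal_mul (by positivity), ENNReal.ofReal_add zero_le_one hθ.le,
            ENNReal.ofReal_one]
      _ ≤ ENNReal.ofReal ((N'' : ℝ) * (e + θ₀)) :=
          ENNReal.ofReal_le_ofReal
            (energy_bookkeeping he hθ.le hθ1 hθe hN0.le hNN'' hC1' hC2')
  -- its flat-mode occupation
  have hy : ENNReal.ofReal (((N : ℝ) / N'') ^ 2 * (c * N - θ * N)) ≤
      occupation N'' (boxConstantMode (sideLength ρ N'')) Φ.ψ := by
    refine le_trans ?_ hΦocc
    rw [ENNReal.ofReal_mul (by positivity), ENNReal.ofReal_sub _ (by positivity)]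
    exact mul_le_mul_right (tsub_le_tsub_right hocc _) _
  have hOΦ : (N'' : ℝ≥0∞) - occupation N'' (boxConstantMode (sideLength ρ N'')) Φ.ψ ≤
      ENNReal.ofReal ((N'' : ℝ) * (1 - c + θ₀)) := by
    refine (natCast_sub_le_ofReal hy).trans (ENNReal.ofReal_le_ofReal ?_)
    have key : (N'' : ℝ) - ((N : ℝ) / N'') ^ 2 * (c * N - θ * N) =
        N'' * (1 - ((N : ℝ) / N'') ^ 2 * (c - θ) * ((N : ℝ) / N'')) := by
      field_simp
    rw [key]
    refine mul_le_mul_of_nonneg_left (occupation_bookkeeping hc1 hθ.le (by positivity)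
      (div_le_one_of_le₀ hNN'' hN''0.le) ?_) hN''0.le
    have h1 : 3 * (1 - (N : ℝ) / N'') = 3 * ((N'' : ℝ) - N) / N'' := by
      field_simp
    have h2 : 3 * ((N'' : ℝ) - N) / N'' ≤ θ₀ / 2 + 3 / N'' := by
      rw [div_le_iff₀ hN''0, add_mul, div_mul_cancel₀ _ hN''0.ne']
      linarith
    have h3 : 3 / (N'' : ℝ) ≤ θ₀ / 4 := by
      rw [div_le_iff₀ hθ₀] at h12
      rw [div_le_iff₀ hN''0]
      linarith
    have h4 : θ ≤ θ₀ / 12 := by nlinarith [mul_nonneg hθ.le he]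
    linarith
  -- assemble
  calc rewardedEnergy v lam Φ
      ≤ ENNReal.ofReal ((N'' : ℝ) * (e + θ₀)) +
          ENNReal.ofReal lam * ENNReal.ofReal ((N'' : ℝ) * (1 - c + θ₀)) :=
        add_le_add hEΦ (mul_le_mul_right hOΦ _)
    _ = ENNReal.ofReal ((N'' : ℝ) * (e + θ₀ + lam * (1 - c + θ₀))) := by
        rw [← ENNReal.ofReal_mul hlam, ← ENNReal.ofReal_add (by positivity)
          (mul_nonneg hlam (mul_nonneg (Nat.cast_nonneg _) (by linarith)))]
        congr 1
        ring

/-- **Registered stub `stub_rewardedUpperBound` — the rewarded upper bound from torus BEC**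
(planner's stub 2; uses the crux hypothesis once, at `(v, ρ)`): given the padded cut-off state,
for every repulsive finite-range `v` there is `ρ₁ > 0` (below the padding cap `ρ̄`, the dilute
threshold of `LSSY2005_e0_periodic_eq_dirichlet_dilute` and `1/(2(1+R)³)`, so that
`E₀^per(N, L_N)/N → e0 v ρ < ∞`) such that for `0 < ρ < ρ₁` and `0 < c ≤ 1`,
`TorusBECAt v ρ c → RewardedUpperBound v ρ c`. [folklore] -/
theorem stub_rewardedUpperBound : RewardedUpperBoundOfTorusBEC := by
  intro hpad v hv
  obtain ⟨R, hR, hv0⟩ := hv.exists_pos_range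
  obtain ⟨ρ₀, hρ₀, hlim⟩ := LSSY2005_e0_periodic_eq_dirichlet_dilute v hv
  obtain ⟨ρbar, hρbar, hpadρ⟩ := hpad v hv
  have hR3 : (0 : ℝ) < 1 / (2 * (1 + R) ^ 3) := by positivity
  refine ⟨min ρbar (min ρ₀ (1 / (2 * (1 + R) ^ 3))), lt_min hρbar (lt_min hρ₀ hR3), ?_⟩
  intro ρ hρ hρ₁ c _hc hc1 hBEC θ₀ hθ₀ lam hlam
  have hρbar' : ρ ≤ ρbar := hρ₁.le.trans (min_le_left _ _)
  have hρ₀' : ρ < ρ₀ := hρ₁.trans_le ((min_le_right _ _).trans (min_le_left _ _))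
  have hρs : ρ < 1 / (2 * (1 + R) ^ 3) :=
    hρ₁.trans_le ((min_le_right _ _).trans (min_le_right _ _))
  -- the thermodynamic limit `E₀^per(N, L_N)/N → e0 v ρ < ∞`
  obtain ⟨hD, hP⟩ := hlim ρ hρ hρ₀'
  have hfin : limsupEnergyPerParticle v ρ ≠ ⊤ := by
    refine (limsup_lt_top_of_small hv.1 hv0 hR hρ ?_).ne
    have h1 : (0 : ℝ) < (1 + R) ^ 3 := by positivity
    rw [lt_div_iff₀ (by positivity)] at hρs
    nlinarith
  have he0 : e0 v ρ = limsupEnergyPerParticle v ρ := hD.limUnder_eq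
  rw [← he0] at hP hfin
  set e := (e0 v ρ).toReal with he_def
  have he_nn : 0 ≤ e := ENNReal.toReal_nonneg
  have he0' : e0 v ρ = ENNReal.ofReal e := (ENNReal.ofReal_toReal hfin).symm
  -- the small parameter `θ`, the padding parameter `M`, `t = 7/M`
  obtain ⟨θ, hθ, hθ1, hθe⟩ : ∃ θ : ℝ, 0 < θ ∧ θ ≤ 1 ∧ θ * (e + 6) ≤ θ₀ / 2 := by
    refine ⟨min 1 (θ₀ / (2 * (e + 6))), lt_min one_pos (by positivity), min_le_left _ _, ?_⟩
    calc min 1 (θ₀ / (2 * (e + 6))) * (e + 6) ≤ θ₀ / (2 * (e + 6)) * (e + 6) :=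
          mul_le_mul_of_nonneg_right (min_le_right _ _) (by positivity)
      _ = θ₀ / 2 := by
          field_simp
  obtain ⟨M₀, hM₀⟩ := hpadρ ρ hρ hρbar' θ hθ
  obtain ⟨M, hMM₀, hM4, hM42⟩ : ∃ M : ℕ, M₀ ≤ M ∧ (4 : ℝ) ≤ M ∧ 42 / θ₀ ≤ M := by
    refine ⟨max M₀ (max 4 ⌈42 / θ₀⌉₊), le_max_left _ _, ?_, ?_⟩
    · exact_mod_cast (le_max_left 4 _).trans (le_max_right M₀ _)
    · exact (Nat.le_ceil _).trans (by exact_mod_cast (le_max_right 4 _).trans (le_max_right M₀ _))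
  obtain ⟨C, N₀, hCN⟩ := hM₀ M hMM₀
  have hM0 : (0 : ℝ) < M := by linarith
  obtain ⟨t, ht0, ht2, h21, hKt⟩ :
      ∃ t : ℝ, 0 ≤ t ∧ t ≤ 2 ∧ 3 * t ≤ θ₀ / 2 ∧ (1 + 7 / (M : ℝ)) = 1 + t := by
    refine ⟨7 / M, by positivity, ?_, ?_, rfl⟩
    · rw [div_le_iff₀ hM0]
      linarith
    · rw [div_le_iff₀ hθ₀] at hM42
      rw [mul_div_assoc', div_le_iff₀ hM0]
      linarith
  rw [hKt] at hCN
  have hK0 : (0 : ℝ) < 1 + t := by linarith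
  -- everything that holds eventually in `N`, pulled back along `N'' ↦ N = ⌊N''/(1+t)⌋`
  have hf : Tendsto (fun n : ℕ => ⌊(n : ℝ) / (1 + t)⌋₊) atTop atTop :=
    tendsto_nat_floor_atTop.comp (tendsto_natCast_atTop_atTop.atTop_div_const hK0)
  have hEv : ∀ᶠ N : ℕ in atTop, energyPerParticlePeriodic v ρ N < e0 v ρ + ENNReal.ofReal θ :=
    (tendsto_order.1 hP).2 _ (ENNReal.lt_add_right hfin (ENNReal.ofReal_pos.2 hθ).ne')
  have hCv : ∀ᶠ N : ℕ in atTop, 4 * max C 0 / θ₀ ≤ (N : ℝ) :=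
    tendsto_natCast_atTop_atTop.eventually_ge_atTop _
  have hLv : ∀ᶠ N : ℕ in atTop, max 1 (4 * max C 0 / θ₀) ≤ sideLength ρ N :=
    (tendsto_sideLength_atTop hρ).eventually_ge_atTop _
  have hBEC' : ∀ᶠ N : ℕ in atTop, ∃ δ : ℝ≥0∞, 0 < δ ∧
      ∀ Ψ : PeriodicTrialState N (sideLength ρ N),
        periodicEnergy v Ψ ≤ periodicGroundStateEnergy v N (sideLength ρ N) + δ →
          ENNReal.ofReal (c * N) ≤ condensateOccupation N (sideLength ρ N) Ψ.ψ := hBEC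
  have hevN : ∀ᶠ N : ℕ in atTop, N₀ ≤ N ∧ 1 ≤ N ∧
      energyPerParticlePeriodic v ρ N < e0 v ρ + ENNReal.ofReal θ ∧
      4 * max C 0 / θ₀ ≤ (N : ℝ) ∧ max 1 (4 * max C 0 / θ₀) ≤ sideLength ρ N ∧
      ∃ δ : ℝ≥0∞, 0 < δ ∧ ∀ Ψ : PeriodicTrialState N (sideLength ρ N),
        periodicEnergy v Ψ ≤ periodicGroundStateEnergy v N (sideLength ρ N) + δ →
          ENNReal.ofReal (c * N) ≤ condensateOccupation N (sideLength ρ N) Ψ.ψ := by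
    filter_upwards [eventually_ge_atTop N₀, eventually_ge_atTop 1, hEv, hCv, hLv, hBEC']
      with N h1 h2 h3 h4 h5 h6
    exact ⟨h1, h2, h3, h4, h5, h6⟩
  filter_upwards [hf.eventually hevN, eventually_ge_atTop ⌈12 / θ₀⌉₊] with N'' hN hN''
  obtain ⟨hN₀, hN1, hEN, hCN1, hLN, δ, hδ, hδΨ⟩ := hN
  obtain ⟨hKN, hN''K, hNN'', hdiff⟩ := floor_bookkeeping ht0 ht2 h21 N''
  have h12 : 12 / θ₀ ≤ (N'' : ℝ) := (Nat.le_ceil _).trans (by exact_mod_cast hN'')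
  rw [he0', ← ENNReal.ofReal_add he_nn hθ.le] at hEN
  exact rewardedInf_le_of_step hc1 hlam he_nn hθ hθ1 hθ₀ hθe hN1 hNN'' hdiff h12 hCN1 hLN hEN hδ
    hδΨ fun Ψ => hCN _ N'' hN₀ hKN hN''K Ψ

end RewardedUpperBound

end Summit.AtomisticToContinuum.BoseEinsteinCondensation.RewardPaysTheWall

end
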